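import Summits.AtomisticToContinuum.Crystallization.Theorems.FrustratedLawDichotomyGSCVanHoveBalls

/-!
# FrustratedLawDichotomy · crux `AperiodicFrustratedLawGap` (stmt-AtomisticToContinuum-27623) — COMPRESSING A VAN HOVE BALL OF A μ-EQUILIBRIUM
# NEVER GAINS (configuration-level one-sided virial; route-independent; decomp-a2c, prover hand 2, structural share, generation 6)

A particle-conserving surgery needs no chemical potential: in a μ-ground-state configuration `X` of Lennard-Jones (any `μ`), replacing the
root-centred ball cluster `C = X ∩ B̄(0, r)` by its homothetic compression `λ·C` (`0 < λ < 1`, which stays inside the emptied ball and at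
distance `≥ (1 − λ)·r` from the rest) cannot lower the energy (Sütő's stability with `k = n`).  With the explicit far field this reads

* `cross_add_le_interactionEnergy_smul` : `U(C) + I(C, X∖C) ≤ U(λ·C) + n·T(δ, (1 − λ)·r)` whenever `(1 − λ)·r ≥ δ`;
* `eventually_le_interactionEnergy_smul` : along the Følner balls of `FrustratedLawDichotomyGSCVanHoveBalls` (or any root-centred van Hove balls with
  `r_j → ∞`) and for every `ε > 0`: eventually `U(C_j) − ε·n_j ≤ U(λ·C_j)`;
* `eventually_density_le_interactionEnergy_smul` : if moreover `U(C_j)/n_j → μc` (for the residual of item 27623: `μc = e⋆`), then eventually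
  `(μc − ε)·n_j ≤ U(λ·C_j)` — the energy density of every compressed copy of the configuration is at least its own: the configuration is
  OPTIMALLY SCALED FROM BELOW (no residual pressure), a census test on the radial distribution of any candidate, again with no `e⋆` in it.

All `[folklore]`.
-/

noncomputable section

namespace Summit.AtomisticToContinuum.Crystallization.Theorems.FrustratedLawDichotomyGSCCompression

open Filter Topology Metric
open Literature.MathematicalPhysics.StatisticalMechanics
open Summit.AtomisticToContinuum.Crystallization.Theorems.ChargedEnergyGapNegative (E3 eStar)
open Summit.AtomisticToContinuum.Crystallization.Theorems.FrustratedLawDichotomyGSCVanHoveBalls (abs_tsum_field_le_of_far)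

variable {δ : ℝ} {X : Set E3}

/-- The field of the rest of `X` (outside the ball of radius `r`) at `k` points of norm `≤ ρ` is at most `k·T(δ, r − ρ)` when `r − ρ ≥ δ`. [folklore] -/
theorem sum_field_le_of_norm_le (hδ : 0 < δ) (hsep : ∀ a ∈ X, ∀ b ∈ X, a ≠ b → δ ≤ dist a b) {r ρ : ℝ} (hρ : δ ≤ r - ρ)
    {n : ℕ} {xf : Fin n → E3} (hrange : Set.range xf = X ∩ closedBall 0 r)
    {k : ℕ} (R : Fin k → E3) (hR : ∀ a, ‖R a‖ ≤ ρ) :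
    ∑ a, ∑' y : ↥(X \ Set.range xf), lennardJones (dist (R a) y) ≤
      (k : ℝ) * ((δ⁻¹ ^ 6 / 12 + 1 / 6) * (1024 / (δ ^ 3 * (r - ρ) ^ 3))) := by
  have hsepY : ∀ a ∈ X \ Set.range xf, ∀ b ∈ X \ Set.range xf, a ≠ b → δ ≤ dist a b :=
    fun a ha b hb hab => hsep a ha.1 b hb.1 hab
  have hfar : ∀ a, ∀ y ∈ X \ Set.range xf, r - ρ ≤ dist (R a) y := fun a y hy => by
    have hyr : r < ‖y‖ := by
      by_contra hle
      exact hy.2 (hrange ▸ ⟨hy.1, by rw [mem_closedBall, dist_zero_right]; exact not_lt.1 hle⟩)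
    have h1 : ‖y‖ - ‖R a‖ ≤ dist (R a) y := by
      rw [dist_comm, dist_eq_norm]; exact norm_sub_norm_le y (R a)
    linarith [hR a]
  calc ∑ a, ∑' y : ↥(X \ Set.range xf), lennardJones (dist (R a) y)
      ≤ ∑ a, |∑' y : ↥(X \ Set.range xf), lennardJones (dist (R a) y)| :=
        Finset.sum_le_sum fun a _ => le_abs_self _
    _ ≤ ∑ _a : Fin k, ((δ⁻¹ ^ 6 / 12 + 1 / 6) * (1024 / (δ ^ 3 * (r - ρ) ^ 3))) :=
        Finset.sum_le_sum fun a _ => abs_tsum_field_le_of_far hδ hsepY (R a) hρ (hfar a)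
    _ = (k : ℝ) * ((δ⁻¹ ^ 6 / 12 + 1 / 6) * (1024 / (δ ^ 3 * (r - ρ) ^ 3))) := by
        rw [Finset.sum_const, Finset.card_univ, Fintype.card_fin, nsmul_eq_mul]

/-- **COMPRESSING A BALL CLUSTER NEVER GAINS** (any `μ`GSC of `V_LJ`, `δ`-separated): for `C = xf(Fin n) = X ∩ B̄(0, r)`, `0 < λ < 1` and
`(1 − λ)·r ≥ δ`:  `U(C) + I(C, X∖C) ≤ U(λ·C) + n·T(δ, (1 − λ)·r)`.  Sütő's stability for the particle-conserving surgery `C ↦ λ·C` (the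
compressed cluster lies in `B̄(0, λr)`, off the rest), plus the far field of the rest at the compressed cluster. [folklore] -/
theorem cross_add_le_interactionEnergy_smul (hδ : 0 < δ) (hsep : ∀ a ∈ X, ∀ b ∈ X, a ≠ b → δ ≤ dist a b)
    {μc : ℝ} (h : IsMuGSC lennardJones μc X) {r : ℝ} {n : ℕ} {xf : Fin n → E3} (hinj : Function.Injective xf)
    (hrange : Set.range xf = X ∩ closedBall 0 r) {c : ℝ} (hc0 : 0 < c) (hc1 : c < 1) (hgap : δ ≤ (1 - c) * r) :
    interactionEnergy lennardJones xf + ∑ i, ∑' y : ↥(X \ Set.range xf), lennardJones (dist (xf i) y) ≤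
      interactionEnergy lennardJones (fun i => c • xf i) + (n : ℝ) * ((δ⁻¹ ^ 6 / 12 + 1 / 6) * (1024 / (δ ^ 3 * ((1 - c) * r) ^ 3))) := by
  have h1c : 0 < 1 - c := by linarith
  have hrpos : 0 < r := by
    have : (1 - c) * 0 < (1 - c) * r := by rw [mul_zero]; exact lt_of_lt_of_le hδ hgap
    exact lt_of_mul_lt_mul_left this h1c.le
  have hxr : ∀ i, ‖xf i‖ ≤ r := fun i => by
    have := (hrange ▸ Set.mem_range_self i : xf i ∈ X ∩ closedBall 0 r).2
    rwa [mem_closedBall, dist_zero_right] at this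
  have hRinj : Function.Injective (fun i => c • xf i) := fun a b hab => hinj (smul_right_injective E3 hc0.ne' hab)
  have hRnorm : ∀ i, ‖c • xf i‖ ≤ c * r := fun i => by
    rw [norm_smul, Real.norm_eq_abs, abs_of_pos hc0]
    exact mul_le_mul_of_nonneg_left (hxr i) hc0.le
  have hdisj : Disjoint (Set.range (fun i => c • xf i)) (X \ Set.range xf) := by
    refine Set.disjoint_left.2 ?_
    rintro _ ⟨a, rfl⟩ hy
    have hyr : r < ‖c • xf a‖ := by
      by_contra hle
      exact hy.2 (hrange.symm ▸ ⟨hy.1, by rw [mem_closedBall, dist_zero_right]; exact not_lt.1 hle⟩)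
    have : c * r < r := by nlinarith
    linarith [hRnorm a]
  have key := h.le hinj (hrange.le.trans Set.inter_subset_left) hRinj hdisj
  have hρ : δ ≤ r - c * r := by linarith
  have hfield := sum_field_le_of_norm_le hδ hsep hρ hrange (fun i => c • xf i) hRnorm
  have hT : (r - c * r) = (1 - c) * r := by ring
  rw [hT] at hfield
  linarith

/-- **Along root-centred van Hove balls, compression never gains in the bulk limit**: for every `0 < λ < 1` and `ε > 0`, eventually
`U(C_j) − ε·n_j ≤ U(λ·C_j)`. [folklore] -/
theorem eventually_le_interactionEnergy_smul (hδ : 0 < δ) (hsep : ∀ a ∈ X, ∀ b ∈ X, a ≠ b → δ ≤ dist a b)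
    {μc : ℝ} (h : IsMuGSC lennardJones μc X)
    {r : ℕ → ℝ} {n : ℕ → ℕ} {xf : ∀ j : ℕ, Fin (n j) → E3}
    (hinj : ∀ j, Function.Injective (xf j)) (hrange : ∀ j, Set.range (xf j) = X ∩ closedBall 0 (r j)) (hnpos : ∀ j, 0 < n j)
    (hr : Tendsto r atTop atTop)
    (hI : Tendsto (fun j => (∑ i, ∑' y : ↥(X \ Set.range (xf j)), lennardJones (dist (xf j i) y)) / (n j : ℝ)) atTop (𝓝 0))
    {c : ℝ} (hc0 : 0 < c) (hc1 : c < 1) {ε : ℝ} (hε : 0 < ε) :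
    ∀ᶠ j in atTop, interactionEnergy lennardJones (xf j) - ε * (n j : ℝ) ≤ interactionEnergy lennardJones (fun i => c • xf j i) := by
  -- the tail `T(δ, (1-c) r_j) → 0` and the cross term per atom `→ 0`
  have hgap_ev : ∀ᶠ j in atTop, δ ≤ (1 - c) * r j := by
    have : Tendsto (fun j => (1 - c) * r j) atTop atTop := hr.const_mul_atTop (by linarith)
    exact this.eventually_ge_atTop δ
  have hT_ev : ∀ᶠ j in atTop, (δ⁻¹ ^ 6 / 12 + 1 / 6) * (1024 / (δ ^ 3 * ((1 - c) * r j) ^ 3)) ≤ ε / 2 := by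
    have hden : Tendsto (fun j => δ ^ 3 * ((1 - c) * r j) ^ 3) atTop atTop :=
      ((tendsto_pow_atTop three_ne_zero).comp (hr.const_mul_atTop (by linarith))).const_mul_atTop (by positivity)
    have h2 : Tendsto (fun j => (δ⁻¹ ^ 6 / 12 + 1 / 6) * ((1024 : ℝ) / (δ ^ 3 * ((1 - c) * r j) ^ 3))) atTop (𝓝 0) := by
      simpa only [mul_zero] using (tendsto_const_nhds.div_atTop hden).const_mul (δ⁻¹ ^ 6 / 12 + 1 / 6)
    exact h2.eventually_le_const (by positivity)
  have hI_ev : ∀ᶠ j in atTop, -(ε / 2) ≤ (∑ i, ∑' y : ↥(X \ Set.range (xf j)), lennardJones (dist (xf j i) y)) / (n j : ℝ) :=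
    hI.eventually_const_le (by linarith)
  filter_upwards [hgap_ev, hT_ev, hI_ev] with j hj1 hj2 hj3
  have hnj : (0 : ℝ) < n j := by exact_mod_cast hnpos j
  have key := cross_add_le_interactionEnergy_smul hδ hsep h (hinj j) (hrange j) hc0 hc1 hj1
  have hI' : -(ε / 2) * (n j : ℝ) ≤ ∑ i, ∑' y : ↥(X \ Set.range (xf j)), lennardJones (dist (xf j i) y) := by
    rwa [le_div_iff₀ hnj] at hj3
  have hT' := mul_le_mul_of_nonneg_left hj2 (Nat.cast_nonneg (n j))
  nlinarith [key, hI', hT']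

/-- **OPTIMALLY SCALED FROM BELOW**: if moreover the ball energy density tends to `μc` (for the residual of item 27623 `μc = e⋆`,
`FrustratedLawDichotomyGSCVanHoveBalls.exists_balls_energyPerAtom_tendsto_eStar`), then for every `0 < λ < 1` and `ε > 0`, eventually
`(μc − ε)·n_j ≤ U(λ·C_j)`: no compressed copy of a van Hove ball has energy density below the configuration's own. [folklore] -/
theorem eventually_density_le_interactionEnergy_smul (hδ : 0 < δ) (hsep : ∀ a ∈ X, ∀ b ∈ X, a ≠ b → δ ≤ dist a b)
    {μ' : ℝ} (h : IsMuGSC lennardJones μ' X)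
    {r : ℕ → ℝ} {n : ℕ → ℕ} {xf : ∀ j : ℕ, Fin (n j) → E3}
    (hinj : ∀ j, Function.Injective (xf j)) (hrange : ∀ j, Set.range (xf j) = X ∩ closedBall 0 (r j)) (hnpos : ∀ j, 0 < n j)
    (hr : Tendsto r atTop atTop)
    (hI : Tendsto (fun j => (∑ i, ∑' y : ↥(X \ Set.range (xf j)), lennardJones (dist (xf j i) y)) / (n j : ℝ)) atTop (𝓝 0))
    {μc : ℝ} (hU : Tendsto (fun j => interactionEnergy lennardJones (xf j) / (n j : ℝ)) atTop (𝓝 μc))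
    {c : ℝ} (hc0 : 0 < c) (hc1 : c < 1) {ε : ℝ} (hε : 0 < ε) :
    ∀ᶠ j in atTop, (μc - ε) * (n j : ℝ) ≤ interactionEnergy lennardJones (fun i => c • xf j i) := by
  have h1 := eventually_le_interactionEnergy_smul hδ hsep h hinj hrange hnpos hr hI hc0 hc1 (half_pos hε)
  have h2 : ∀ᶠ j in atTop, μc - ε / 2 ≤ interactionEnergy lennardJones (xf j) / (n j : ℝ) := hU.eventually_const_le (by linarith)
  filter_upwards [h1, h2] with j hj1 hj2
  have hnj : (0 : ℝ) < n j := by exact_mod_cast hnpos j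
  rw [le_div_iff₀ hnj] at hj2
  linarith

end Summit.AtomisticToContinuum.Crystallization.Theorems.FrustratedLawDichotomyGSCCompression

end
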